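import Literature.Barriers.SmoothPoincare4.PropertyTwoRAndrewsCurtisProofs
import Literature.Topology.FourManifolds.BalancedPresentationProofs
import HarnessLib

/-!
# Barrier (SmoothPoincare4) `PropertyTwoRAndrewsCurtis`: what the hypothesis `AKPresentationsACNontrivial` asks

Proofs companion (theorems only: no definition, no named fact) of
`Literature/Barriers/SmoothPoincare4/PropertyTwoRAndrewsCurtis.lean` and of its proofs siblings
`PropertyTwoRAndrewsCurtisACMoves.lean`, `PropertyTwoRAndrewsCurtisProofs.lean`.

The hypothesis of the barrier, `Literature.Barriers.SmoothPoincare4.AKPresentationsACNontrivial` —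
"for some `n ≥ 3` the presentation `gstPresentation n = ⟨x, y ∣ yxy = xyx, xⁿ⁺¹ = yⁿ⟩` (the
Akbulut–Kirby presentation `AK(n)` up to renaming) is NOT Andrews–Curtis equivalent to the trivial
presentation" — is an OPEN statement. Gompf–Scharlemann–Thompson (= GST) print it as an
expectation only: "For `k = 1`, for example, this is regarded as very unlikely when `n ≥ 3`. (For
`n ≤ 2`, see Section 8.)", and "Unfortunately, there is presently no way to distinguish
Andrews-Curtis equivalence classes from each other. When such technology emerges, it should be
able to distinguish handle-slide equivalence classes of links" [GompfScharlemannThompson2010, §7].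
A proof of it would exhibit an Andrews–Curtis nontrivial balanced presentation of the trivial
group, i.e. DISPROVE the Andrews–Curtis conjecture in its unstable rank-two form; no such proof is
known (the presentations `AK(n)`, `n ≥ 3`, are the standard potential counterexamples, open since
Akbulut–Kirby 1985), so the `def … : Prop` is a conjecture used as a hypothesis
(`PropertyTwoRBarrier`, `StrictPropertyTwoRBarrier`), not a citable theorem awaiting a proof.
This file records, as theorems, exactly what the statement asks:

* `presentsTrivialGroup_gstPresentation` — **non-vacuity**: every `gstPresentation n` presents the
  trivial group (GST §1: "the presentation `⟨x, y ∣ yxy = xyx, xⁿ⁺¹ = yⁿ⟩` of the trivial group"),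
  by the Akbulut–Kirby argument `Literature.Topology.FourManifolds.eq_one_of_braid_of_pow_eq_pow_succ`;
  so each instance `¬ IsAndrewsCurtisEquivalent (gstPresentation n) (trivial 2)` is a genuine
  instance of the Andrews–Curtis problem;
* `not_akPresentationsACNontrivial_iff` — **the negation of the hypothesis is the (unstable)
  Andrews–Curtis conjecture restricted to the family**: `¬ AKPresentationsACNontrivial ↔ ∀ n,
  IsAndrewsCurtisEquivalent (gstPresentation n) (trivial 2)` (the cases `n ≤ 2` being settled,
  `akPresentationsACNontrivial_iff_exists` of `PropertyTwoRAndrewsCurtisProofs.lean`); neither side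
  is known;
* `akPresentationsACNontrivial_iff_exists_akbulutKirby` — the same over the tree's Akbulut–Kirby
  family: the hypothesis says that SOME `akbulutKirby k = AK(k + 2)` is Andrews–Curtis nontrivial
  (the guard `1 ≤ k` of `akPresentationsACNontrivial_iff_akbulutKirby` is redundant, `AK(2)` being
  trivial — Gersten, `isAndrewsCurtisEquivalent_akbulutKirby_zero_trivial`);
* `isStablyAndrewsCurtisEquivalent_gstPresentation_of_andrewsCurtisConjecture` — **what the tree's
  catalogued conjecture says here**: `Literature.Topology.FourManifolds.AndrewsCurtisConjecture`
  (the STABLE form, over all balanced presentations of the trivial group) would make every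
  `gstPresentation n` stably Andrews–Curtis trivial; it neither asserts nor denies the UNSTABLE
  nontriviality `AKPresentationsACNontrivial` (GST §9: "stabilization by adding a distant unknot …
  preserves the Andrews-Curtis class" concerns the stable class; the barrier file's `blocks:` line
  records the stable variant separately).

## What is not here

Nothing deciding `AKPresentationsACNontrivial`: neither it nor its negation is proved, for any
`n ≥ 3` (open in both directions [GompfScharlemannThompson2010, §7]).

## References

* R. E. Gompf, M. Scharlemann, A. Thompson, *Fibered knots and potential counterexamples to the
  Property 2R and Slice-Ribbon Conjectures*, Geom. Topol. 14 (2010) 2305–2347, §1, §7, §8, §9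
  (arXiv:1103.1601 pp. 3, 17, 18, 19). [GompfScharlemannThompson2010]
* S. Akbulut, R. Kirby, Topology 24 (1985), §1. [AkbulutKirby1985]
* C. Hog-Angeloni, W. Metzler (eds.), *Two-dimensional homotopy and combinatorial group theory*
  (1993), Ch. XII §1.1 (1c). [HogAngeloniMetzler1993]
* J. J. Andrews, M. L. Curtis, Proc. AMS 16 (1965). [AndrewsCurtis1965]
-/

noncomputable section

namespace Literature.Barriers.SmoothPoincare4

open Literature.Topology.FourManifolds

/-! ### Non-vacuity: the presentations present the trivial group -/

/-- **Every `⟨x, y ∣ yxy = xyx, xⁿ⁺¹ = yⁿ⟩` presents the trivial group** (GST §1: "the presentation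
`⟨x, y ∣ yxy = xyx, xⁿ⁺¹ = yⁿ⟩` of the trivial group"): in the presented group `ȳ x̄ ȳ = x̄ ȳ x̄` and
`ȳⁿ = x̄ⁿ⁺¹`, so both generators die by the Akbulut–Kirby argument
`Literature.Topology.FourManifolds.eq_one_of_braid_of_pow_eq_pow_succ` (Hog-Angeloni–Metzler,
Ch. XII §1.1 (1c)), and the generators generate. Hence each conjunct
`¬ IsAndrewsCurtisEquivalent (gstPresentation n) (trivial 2)` of the barrier hypothesis is a genuine
instance of the Andrews–Curtis problem. [cite: GompfScharlemannThompson2010, §1 (p. 2)] -/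
theorem presentsTrivialGroup_gstPresentation (n : ℕ) :
    (gstPresentation n).PresentsTrivialGroup := by
  have h₂ : (PresentedGroup.of 1 : PresentedGroup (Set.range (gstPresentation n))) *
      PresentedGroup.of 0 * PresentedGroup.of 1 =
      PresentedGroup.of 0 * PresentedGroup.of 1 * PresentedGroup.of 0 := by
    have h := PresentedGroup.one_of_mem (rels := Set.range (gstPresentation n)) ⟨0, rfl⟩
    simp only [gstPresentation_zero, map_mul, map_inv] at h
    exact mul_inv_eq_one.1 h
  have h₁ : (PresentedGroup.of 1 : PresentedGroup (Set.range (gstPresentation n))) ^ n =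
      PresentedGroup.of 0 ^ (n + 1) := by
    have h := PresentedGroup.one_of_mem (rels := Set.range (gstPresentation n)) ⟨1, rfl⟩
    simp only [gstPresentation_one, map_mul, map_inv, map_pow] at h
    exact (mul_inv_eq_one.1 h).symm
  obtain ⟨hy, hx⟩ := eq_one_of_braid_of_pow_eq_pow_succ h₁ h₂
  have hgen : ∀ j : Fin 2,
      (PresentedGroup.of j : PresentedGroup (Set.range (gstPresentation n))) ∈ (⊥ : Subgroup _) :=
    Fin.forall_fin_two.2 ⟨by simpa using hx, by simpa using hy⟩
  have hall : ∀ g : PresentedGroup (Set.range (gstPresentation n)), g = 1 := fun g ↦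
    (Subgroup.mem_bot).1 (PresentedGroup.generated_by _ ⊥ hgen g)
  exact subsingleton_of_forall_eq 1 hall

/-! ### The hypothesis and the Andrews–Curtis conjecture -/

/-- **The negation of the barrier hypothesis is the (unstable) Andrews–Curtis conjecture on the
family**: `¬ AKPresentationsACNontrivial` iff EVERY `⟨x, y ∣ yxy = xyx, xⁿ⁺¹ = yⁿ⟩` reduces to the
trivial presentation by the three relator moves (the cases `n ≤ 2` are settled,
`akPresentationsACNontrivial_iff_exists`; for `n ≥ 3` GST regard triviality "as very unlikely",
while "there is presently no way to distinguish Andrews-Curtis equivalence classes from each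
other" — open in both directions). [cite: GompfScharlemannThompson2010, §7] -/
theorem not_akPresentationsACNontrivial_iff :
    ¬ AKPresentationsACNontrivial ↔
      ∀ n : ℕ, IsAndrewsCurtisEquivalent (gstPresentation n)
        (BalancedPresentation.trivial 2) := by
  rw [akPresentationsACNontrivial_iff_exists]
  push Not
  rfl

/-- **Over the Akbulut–Kirby family**: the barrier hypothesis says that SOME
`akbulutKirby k = AK(k + 2) = ⟨x, y ∣ xᵏ⁺² = yᵏ⁺³, xyx = yxy⟩` is Andrews–Curtis nontrivial — the
guard `1 ≤ k` of `akPresentationsACNontrivial_iff_akbulutKirby` is redundant since `AK(2)` is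
trivial (Gersten; `isAndrewsCurtisEquivalent_akbulutKirby_zero_trivial`). A proof of the hypothesis
is thus precisely a disproof of the Andrews–Curtis conjecture on its standard test family.
[cite: GompfScharlemannThompson2010, §7 and §8] -/
theorem akPresentationsACNontrivial_iff_exists_akbulutKirby :
    AKPresentationsACNontrivial ↔
      ∃ k : ℕ, ¬ IsAndrewsCurtisEquivalent (akbulutKirby k)
        (BalancedPresentation.trivial 2) := by
  rw [akPresentationsACNontrivial_iff_akbulutKirby]
  constructor
  · rintro ⟨k, -, hk⟩
    exact ⟨k, hk⟩
  · rintro ⟨k, hk⟩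
    refine ⟨k, ?_, hk⟩
    rcases k with _ | k
    · exact absurd isAndrewsCurtisEquivalent_akbulutKirby_zero_trivial hk
    · omega

/-- **What the tree's (stable) Andrews–Curtis conjecture says about the family**: it would make
every `⟨x, y ∣ yxy = xyx, xⁿ⁺¹ = yⁿ⟩` STABLY Andrews–Curtis trivial
(`Literature.Topology.FourManifolds.AndrewsCurtisConjecture` quantifies over all balanced
presentations of the trivial group and over stabilisations; the family presents the trivial
group by `presentsTrivialGroup_gstPresentation`). The barrier hypothesis
`AKPresentationsACNontrivial` is the UNSTABLE nontriviality of some member with `n ≥ 3`, which the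
stable conjecture neither asserts nor denies. [folklore] -/
theorem isStablyAndrewsCurtisEquivalent_gstPresentation_of_andrewsCurtisConjecture
    (h : AndrewsCurtisConjecture) (n : ℕ) :
    IsStablyAndrewsCurtisEquivalent (gstPresentation n) (BalancedPresentation.trivial 2) :=
  h 2 _ (presentsTrivialGroup_gstPresentation n)

end Literature.Barriers.SmoothPoincare4

end
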